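import Summits.AtomisticToContinuum.Crystallization.Theorems.FrustratedLawDichotomyCoherentFloorHalo

/-!
# FrustratedLawDichotomy · crux `AperiodicFrustratedLawGap` (stmt-AtomisticToContinuum-27623) — T2-H WITH DIALLED CLEARANCES (K-file form of the class-H door)
# (decomp-a2c hand-1 g52; amendment (a)/(b) of lens-5 g113's REPLY 2026-09-04T10:41:25Z: per-site clearances as PARAMETERS)

`…CoherentFloorHalo` states the class-H door with the exact clearances `Rc − (‖x‖ + τ)` (ball) and `s − (⟪x,n⟫ + τ)` (plane) inside `farCol`/`halfCol`.
A cell K-file works with RATIONAL per-site dials; `farCol` is antitone ((238) `farCol_anti`) but `halfCol` needs no monotonicity lemma if the door itself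
takes the dials: here every interior site `x ∈ I` carries `dB x, dH x ≥ 7/20` with `dB x ≤ Rc − (‖x‖ + τ)`, `dH x ≤ s − (⟪x,n⟫ + τ)`, and the columns are
`farCol (dB x) + halfCol (dH x)`.  With `s ≥ Rc + 1` the plane misses the ball entirely: ONE door for class A (ball), class H (ball ∩ half-space) and
vacancy rows (template minus the vacant site), as lens-5 asked.

* `norm_sum_template_force_le_halo_dial`, ★★★ `certFloorHalo_le_two_mul_rootEnergy_dial` / `…_dial_of_nash`.
DEF-FREE; imports TREE `…CoherentFloorHalo` (p859456); 0 sorry.  All `[folklore]`.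
-/

noncomputable section

namespace Summit.AtomisticToContinuum.Crystallization.Theorems.FrustratedLawDichotomyCoherentFloorHaloDial

open MeasureTheory Metric Set Filter RealInnerProductSpace
open scoped BigOperators Topology ENNReal
open Literature.MathematicalPhysics.StatisticalMechanics (lennardJones rootEnergy rootEnergy_def)
open Literature.Probability.Process (IsRootedHardCore count_restrict_singleton_ne_zero_iff)
open Summit.AtomisticToContinuum.Crystallization.Theorems.ChargedEnergyGapNegative (E3)
open Summit.AtomisticToContinuum.Crystallization.Theorems.FrustratedLawDichotomyCoherentWindow
open Summit.AtomisticToContinuum.Crystallization.Theorems.FrustratedLawDichotomyCoherentOn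
open Summit.AtomisticToContinuum.Crystallization.Theorems.FrustratedLawDichotomyFarForceColumn (sum_norm_force_le_sevenTenths
  sum_norm_force_le_sevenTenths_of_far_from_root)
open Summit.AtomisticToContinuum.Crystallization.Theorems.FrustratedLawDichotomyHalfSpaceCapSharp
  (sum_norm_force_le_of_separated_halfspace_sharp_sevenTenths)
open Summit.AtomisticToContinuum.Crystallization.Theorems.FrustratedLawDichotomyTransportPriceTail (integrable_lennardJones_of_isRootedHardCore)
open Summit.AtomisticToContinuum.Crystallization.Theorems.FrustratedLawDichotomyNashForceBalance (hasSum_force_of_nash)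
open Summit.AtomisticToContinuum.Crystallization.Theorems.FrustratedLawDichotomyCoherentFloorAlgebra
open Summit.AtomisticToContinuum.Crystallization.Theorems.FrustratedLawDichotomyCoherentFloor
open Summit.AtomisticToContinuum.Crystallization.Theorems.FrustratedLawDichotomyCoherentFloorHalo

/-- ★ THE FORCE-BALANCE SPLIT with DIALLED CLEARANCES: as `…CoherentFloorHalo.norm_sum_template_force_le_halo`, but the two columns are
evaluated at any clearances `dB ≤ Rc − (‖x‖ + τ)`, `dH ≤ s − (⟪x,n⟫ + τ)` (both `≥ 7/20`) — the rational per-site dials of a K-file. [folklore] -/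
theorem norm_sum_template_force_le_halo_dial {S : Set E3} {τ Rc s : ℝ} {a : Finset E3} {n : E3} (hn : ‖n‖ = 1)
    (hS : ∀ p ∈ S, ∀ p' ∈ S, p ≠ p' → (7 : ℝ) / 10 ≤ dist p p') (hτ : 2 * τ < 7 / 10)
    (hcoh : (Measure.count.restrict S : Measure E3) ∈ coherentOn a τ (haloWindow n s Rc))
    (ha : ∀ x ∈ a, ∀ x' ∈ a, x ≠ x' → 2 * τ < dist x x') (hin : ∀ x ∈ a, ‖x‖ + τ ≤ Rc ∧ ⟪x, n⟫ + τ ≤ s)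
    {x : E3} (hx : x ∈ a) {dB dH : ℝ} (hdB : 7 / 20 ≤ dB) (hdB' : dB ≤ Rc - (‖x‖ + τ)) (hdH : 7 / 20 ≤ dH) (hdH' : dH ≤ s - (⟪x, n⟫ + τ))
    (hbal : HasSum (fun q : {q : E3 // (Measure.count.restrict S : Measure E3) {q} ≠ 0 ∧ q ≠ atomOf S τ x} =>
      ((dist (atomOf S τ x) (q : E3))⁻¹ ^ 8 - (dist (atomOf S τ x) (q : E3))⁻¹ ^ 14) • (atomOf S τ x - (q : E3))) 0) :
    ‖∑ x' ∈ a.erase x, ljBondForce (atomOf S τ x - atomOf S τ x')‖ ≤ farCol dB + halfCol dH := by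
  classical
  have h7 : (0 : ℝ) < 7 / 10 := by norm_num
  have hW := measurableSet_haloWindow n s Rc
  have hne : ∀ z ∈ a, (closedBall z τ ∩ S).Nonempty := fun z hz => nonempty_of_mem_coherentOn hW hcoh hz
  have hballs : ∀ z ∈ a, closedBall z τ ⊆ haloWindow n s Rc := fun z hz => closedBall_subset_haloWindow hn (hin z hz).1 (hin z hz).2
  set p : E3 := atomOf S τ x with hp
  have hpS : p ∈ S := (atomOf_mem (hne x hx)).2
  have hpn : ‖p‖ ≤ ‖x‖ + τ := norm_atomOf_le (hne x hx)
  have hpin : ⟪p, n⟫ ≤ ⟪x, n⟫ + τ := by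
    have h1 : ‖p - x‖ ≤ τ := norm_atomOf_sub_le (hne x hx)
    have h2 : ⟪p - x, n⟫ ≤ ‖p - x‖ := by
      have := abs_real_inner_le_norm (p - x) n
      rw [hn, mul_one] at this
      exact (le_abs_self _).trans this
    have h3 : ⟪p, n⟫ = ⟪x, n⟫ + ⟪p - x, n⟫ := by rw [← inner_add_left, add_sub_cancel]
    linarith
  set T := {q : E3 // (Measure.count.restrict S : Measure E3) {q} ≠ 0 ∧ q ≠ p}
  set f : T → E3 := fun q => ((dist p (q : E3))⁻¹ ^ 8 - (dist p (q : E3))⁻¹ ^ 14) • (p - (q : E3)) with hf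
  have hmemT : ∀ q : T, (q : E3) ∈ S ∧ (q : E3) ≠ p := fun q =>
    ⟨(count_restrict_singleton_ne_zero_iff S q).mp q.2.1, q.2.2⟩
  have hdistT : ∀ q : T, (7 : ℝ) / 10 ≤ dist (q : E3) p := fun q => hS _ (hmemT q).1 p hpS (hmemT q).2
  -- the norms are summable
  have hnorm : Summable fun q : T => ‖f q‖ := by
    refine summable_of_sum_le (fun q => norm_nonneg _) (c := farCol (7 / 10)) fun u => ?_
    have hmap : ∑ q ∈ u, ‖f q‖ =
        ∑ q ∈ u.map (Function.Embedding.subtype _), ‖((dist p q)⁻¹ ^ 8 - (dist p q)⁻¹ ^ 14) • (p - q)‖ := by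
      rw [Finset.sum_map]; rfl
    rw [hmap]
    unfold farCol
    refine sum_norm_force_le_sevenTenths _ p (by norm_num) (fun q hq q' hq' hqq' => ?_) (fun q hq => ?_)
    · obtain ⟨w, -, rfl⟩ := Finset.mem_map.mp hq
      obtain ⟨w', -, rfl⟩ := Finset.mem_map.mp hq'
      exact hS _ (hmemT w).1 _ (hmemT w').1 hqq'
    · obtain ⟨w, -, rfl⟩ := Finset.mem_map.mp hq
      exact hdistT w
  -- the window part of `T`
  have hfin : (S ∩ haloWindow n s Rc).Finite := finite_inter_of_coherentOn hS hτ hW hcoh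
  have hnear : {q : T | (q : E3) ∈ haloWindow n s Rc}.Finite :=
    Finite.of_injOn (f := fun q : T => (q : E3)) (t := S ∩ haloWindow n s Rc) (fun q hq => ⟨(hmemT q).1, hq⟩)
      Subtype.val_injective.injOn hfin
  set sW : Finset T := hnear.toFinset with hsW
  have hsplit := hbal.summable.sum_add_tsum_compl (s := sW)
  rw [hbal.tsum_eq] at hsplit
  have hsum_s : ∑ q ∈ sW, f q = -∑' q : ↑((↑sW : Set T)ᶜ), f q := eq_neg_of_add_eq_zero_left hsplit
  -- complement points lie outside the window: outside the ball or beyond the plane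
  have hout : ∀ q : ↑((↑sW : Set T)ᶜ), ((q : T) : E3) ∉ haloWindow n s Rc := fun q => by
    have h1 : (q : T) ∉ (↑sW : Set T) := q.2
    have h2 : (q : T) ∉ hnear.toFinset := h1
    rwa [Finite.mem_toFinset] at h2
  have hnormc : Summable fun q : ↑((↑sW : Set T)ᶜ) => ‖f q‖ := hnorm.subtype _
  have htail : ∑' q : ↑((↑sW : Set T)ᶜ), ‖f q‖ ≤ farCol dB + halfCol dH := by
    refine hnormc.tsum_le_of_sum_le fun u => ?_
    set emb : ↑((↑sW : Set T)ᶜ) ↪ E3 := ⟨fun q => ((q : T) : E3), fun q q' hqq' => Subtype.ext (Subtype.ext hqq')⟩ with hemb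
    have hmap : ∑ q ∈ u, ‖f q‖ = ∑ q ∈ u.map emb, ‖((dist p q)⁻¹ ^ 8 - (dist p q)⁻¹ ^ 14) • (p - q)‖ := by
      rw [Finset.sum_map]; rfl
    rw [hmap]
    set v := u.map emb with hv
    have hvS : ∀ q ∈ v, q ∈ S ∧ q ∉ haloWindow n s Rc := fun q hq => by
      obtain ⟨w, -, rfl⟩ := Finset.mem_map.mp hq
      exact ⟨(hmemT w).1, hout w⟩
    have hvsep : ∀ q ∈ v, ∀ q' ∈ v, q ≠ q' → (7 : ℝ) / 10 ≤ dist q q' := fun q hq q' hq' hqq' =>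
      hS q (hvS q hq).1 q' (hvS q' hq').1 hqq'
    -- split `v` into the part outside the ball and the part (inside the ball) beyond the plane
    rw [← Finset.sum_filter_add_sum_filter_not v (fun q => q ∈ closedBall (0 : E3) Rc)]
    have hA : ∑ q ∈ v.filter (fun q => ¬ q ∈ closedBall (0 : E3) Rc), ‖((dist p q)⁻¹ ^ 8 - (dist p q)⁻¹ ^ 14) • (p - q)‖
        ≤ farCol dB := by
      have hρ : dist p 0 ≤ Rc - dB := by rw [dist_zero_right]; linarith
      have hR' : 7 / 20 ≤ Rc - (Rc - dB) := by linarith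
      have h := sum_norm_force_le_sevenTenths_of_far_from_root (v.filter (fun q => ¬ q ∈ closedBall (0 : E3) Rc)) p 0 hρ hR'
        (fun q hq q' hq' hqq' => hvsep q (Finset.mem_filter.mp hq).1 q' (Finset.mem_filter.mp hq').1 hqq') (fun q hq => ?_)
      · have e : Rc - (Rc - dB) = dB := by ring
        rw [e] at h
        unfold farCol
        exact h
      have h := (Finset.mem_filter.mp hq).2
      rw [mem_closedBall, not_le] at h
      exact h.le
    have hB : ∑ q ∈ v.filter (fun q => q ∈ closedBall (0 : E3) Rc), ‖((dist p q)⁻¹ ^ 8 - (dist p q)⁻¹ ^ 14) • (p - q)‖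
        ≤ halfCol dH := by
      unfold halfCol
      refine sum_norm_force_le_of_separated_halfspace_sharp_sevenTenths _ p n hn hdH
        (fun q hq q' hq' hqq' => hvsep q (Finset.mem_filter.mp hq).1 q' (Finset.mem_filter.mp hq').1 hqq') (fun q hq => ?_)
      obtain ⟨hqv, hqball⟩ := Finset.mem_filter.mp hq
      have hq2 : ¬ ⟪q, n⟫ ≤ s := fun h => (hvS q hqv).2 ⟨hqball, h⟩
      rw [inner_sub_left]
      linarith [not_le.mp hq2]
    linarith
  -- the window part of the balance is the template sum
  have hmapS : sW.map (Function.Embedding.subtype _) = (a.erase x).image (atomOf S τ) := by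
    ext q
    rw [Finset.mem_map, Finset.mem_image]
    constructor
    · rintro ⟨w, hw, rfl⟩
      rw [hsW, Finite.mem_toFinset] at hw
      obtain ⟨x', hx', hEq⟩ := inter_subset_image_atomOf_of_coherentOn hS hτ hW hcoh ⟨(hmemT w).1, hw⟩
      refine ⟨x', Finset.mem_erase.mpr ⟨?_, hx'⟩, hEq⟩
      rintro rfl
      exact (hmemT w).2 hEq.symm
    · rintro ⟨x', hx', hq⟩
      have hx'a := Finset.mem_of_mem_erase hx'
      have hm := atomOf_mem (hne x' hx'a)
      have hneq : atomOf S τ x' ≠ p := fun h =>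
        Finset.ne_of_mem_erase hx' ((injOn_atomOf ha hne) hx'a hx h)
      refine ⟨⟨atomOf S τ x', (count_restrict_singleton_ne_zero_iff S _).mpr hm.2, hneq⟩, ?_, hq⟩
      rw [hsW, Finite.mem_toFinset]
      exact hballs x' hx'a hm.1
  have hwin : ∑ q ∈ sW, f q = ∑ x' ∈ a.erase x, ljBondForce (p - atomOf S τ x') :=
    calc ∑ q ∈ sW, f q = ∑ q ∈ sW.map (Function.Embedding.subtype _), ((dist p q)⁻¹ ^ 8 - (dist p q)⁻¹ ^ 14) • (p - q) := by
          rw [Finset.sum_map]; rfl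
      _ = ∑ q ∈ (a.erase x).image (atomOf S τ), ((dist p q)⁻¹ ^ 8 - (dist p q)⁻¹ ^ 14) • (p - q) := by rw [hmapS]
      _ = ∑ x' ∈ a.erase x, ((dist p (atomOf S τ x'))⁻¹ ^ 8 - (dist p (atomOf S τ x'))⁻¹ ^ 14) • (p - atomOf S τ x') :=
          Finset.sum_image fun x₁ h₁ x₂ h₂ h =>
            (injOn_atomOf ha hne) (Finset.mem_of_mem_erase h₁) (Finset.mem_of_mem_erase h₂) h
      _ = ∑ x' ∈ a.erase x, ljBondForce (p - atomOf S τ x') := Finset.sum_congr rfl fun x' _ => force_eq_ljBondForce _ _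
  rw [← hwin, hsum_s, norm_neg]
  exact (norm_tsum_le_tsum_norm hnormc).trans htail


/-- ★★★ **T2-H WITH DIALLED CLEARANCES.**  As `…CoherentFloorHalo.certFloorHalo_le_two_mul_rootEnergy`, with the two per-site columns
evaluated at rational dials `dB x ≤ Rc − (‖x‖+τ)`, `dH x ≤ s − (⟪x,n⟫+τ)` (both `≥ 7/20` on `I`) — the form a K-file instantiates (no monotonicity
lemma for `halfCol` needed; with `s ≥ Rc + 1` the window is the whole ball and this is the class-A door up to the tiny `halfCol/halfEnergyCol`).   `S ∋ 0`
`7/10`-separated and coherent with the template `a ∋ 0` on the halo window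
`B̄(0,Rc) ∩ {⟪z,n⟫ ≤ s}` (`‖n‖ = 1`, `s ≥ 1`, `Rc ≥ 1`, every template ball inside the window), interior `I ⊆ a` whose actual atoms are in force
equilibrium and at least `7/20` inside both the ball and the half-space, ANY multipliers `y`: the CERTIFICATE FLOOR of PART B with the far column
`farCol + halfCol` per interior site and the extra energy debit `halfEnergyCol s` is at most `2·rootEnergy V_LJ (count⌊S)`. [folklore] -/
theorem certFloorHalo_le_two_mul_rootEnergy_dial {S : Set E3} {τ Rc s : ℝ} {a I : Finset E3} {n : E3} (y : E3 → E3) (dB dH : E3 → ℝ)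
    (hn : ‖n‖ = 1) (hs : 1 ≤ s)
    (hS : ∀ p ∈ S, ∀ p' ∈ S, p ≠ p' → (7 : ℝ) / 10 ≤ dist p p') (h0S : (0 : E3) ∈ S)
    (hτ0 : 0 ≤ τ) (hτ : 2 * τ < 7 / 10) (hRc : 1 ≤ Rc)
    (hcoh : (Measure.count.restrict S : Measure E3) ∈ coherentOn a τ (haloWindow n s Rc))
    (h0a : (0 : E3) ∈ a) (hIa : I ⊆ a) (ha : ∀ x ∈ a, ∀ x' ∈ a, x ≠ x' → 2 * τ < dist x x')
    (hin : ∀ x ∈ a, ‖x‖ + τ ≤ Rc ∧ ⟪x, n⟫ + τ ≤ s) (hI : ∀ x ∈ I, (7 / 20 ≤ dB x ∧ dB x ≤ Rc - (‖x‖ + τ)) ∧ (7 / 20 ≤ dH x ∧ dH x ≤ s - (⟪x, n⟫ + τ)))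
    (hbal : ∀ x ∈ I, HasSum (fun q : {q : E3 // (Measure.count.restrict S : Measure E3) {q} ≠ 0 ∧ q ≠ atomOf S τ x} =>
      ((dist (atomOf S τ x) (q : E3))⁻¹ ^ 8 - (dist (atomOf S τ x) (q : E3))⁻¹ ^ 14) • (atomOf S τ x - (q : E3))) 0) :
    ∑ x ∈ a.erase 0, (phiT (‖x‖ ^ 2) - (τ ^ 2 * secondNeg ‖x‖ + energyRem ‖x‖ τ))
        - τ * ∑ z ∈ a.erase 0, ‖psiT (‖z‖ ^ 2) • z - certCoeff a I y z‖
        - ∑ x ∈ I, ⟪y x, ∑ x' ∈ a.erase x, ljBondForce (x - x')⟫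
        - ∑ x ∈ I, ‖y x‖ * (farCol (dB x) + halfCol (dH x))
        - 1 / 2 * ∑ x ∈ a, ∑ x' ∈ a.erase x, ‖mulExt I y x - mulExt I y x'‖ * forceRem ‖x - x'‖ (dispB τ x + dispB τ x')
        - tailCol Rc - halfEnergyCol s
      ≤ 2 * rootEnergy lennardJones (Measure.count.restrict S : Measure E3) := by
  classical
  have h7 : (0 : ℝ) < 7 / 10 := by norm_num
  have hW := measurableSet_haloWindow n s Rc
  have hne : ∀ z ∈ a, (closedBall z τ ∩ S).Nonempty := fun z hz => nonempty_of_mem_coherentOn hW hcoh hz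
  have hballs : ∀ z ∈ a, closedBall z τ ⊆ haloWindow n s Rc := fun z hz => closedBall_subset_haloWindow hn (hin z hz).1 (hin z hz).2
  -- the displacement field of the coherent window
  set d : E3 → E3 := fun z => atomOf S τ z - z with hd
  have hq : ∀ z, z + d z = atomOf S τ z := fun z => by
    show z + (atomOf S τ z - z) = atomOf S τ z
    abel
  have hd0 : d 0 = 0 := by
    have h := atomOf_zero hS hτ h0S hτ0
    show atomOf S τ 0 - 0 = 0
    rw [h, sub_zero]
  have hdτ : ∀ z ∈ a, ‖d z‖ ≤ τ := fun z hz => norm_atomOf_sub_le (hne z hz)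
  have hdisp : ∀ z ∈ a, ‖d z‖ ≤ dispB τ z := fun z hz => by
    unfold dispB
    split_ifs with h
    · rw [h, hd0, norm_zero]
    · exact hdτ z hz
  have hdispτ : ∀ z : E3, dispB τ z ≤ τ := fun z => by unfold dispB; split_ifs <;> linarith
  -- (i) energy slots
  have heR : ∀ x ∈ a.erase 0,
      phiT (‖x‖ ^ 2) + psiT (‖x‖ ^ 2) * ⟪x, d x⟫ - (τ ^ 2 * secondNeg ‖x‖ + energyRem ‖x‖ τ) ≤ phiT (‖x + d x‖ ^ 2) := by
    intro x hx
    obtain ⟨hx0, hxa⟩ := Finset.mem_erase.mp hx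
    have hxτ : τ < ‖x‖ := by
      have h := ha x hxa 0 h0a hx0
      rw [dist_zero_right] at h
      linarith
    exact phiT_taylor_ge x (d x) (hdτ x hxa) hxτ
  -- (iv) force-remainder slots
  have hfR : ∀ x ∈ I, ∀ x' ∈ a.erase x, ‖ljBondForce ((x + d x) - (x' + d x')) - ljBondForce (x - x') - ljBondForceLin (x - x') (d x - d x')‖
      ≤ forceRem ‖x - x'‖ (dispB τ x + dispB τ x') := by
    intro x hx x' hx'
    obtain ⟨hx'x, hx'a⟩ := Finset.mem_erase.mp hx'
    have hxa := hIa hx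
    have e : (x + d x) - (x' + d x') = (x - x') + (d x - d x') := by abel
    rw [e]
    refine norm_ljBondForce_taylor_le (x - x') (d x - d x') ((norm_sub_le _ _).trans (add_le_add (hdisp x hxa) (hdisp x' hx'a))) ?_
    have h3 := ha x hxa x' hx'a (Ne.symm hx'x)
    rw [dist_eq_norm] at h3
    linarith [hdispτ x, hdispτ x']
  -- (iv, far part) the force balance split, halo form
  have hC : ∀ x ∈ I, ‖∑ x' ∈ a.erase x, ljBondForce ((x + d x) - (x' + d x'))‖ ≤ farCol (dB x) + halfCol (dH x) := by
    intro x hx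
    simp_rw [hq]
    exact norm_sum_template_force_le_halo_dial hn hS hτ hcoh ha hin (hIa hx) (hI x hx).1.1 (hI x hx).1.2 (hI x hx).2.1 (hI x hx).2.2
      (hbal x hx)
  have hcore := windowSum_ge a I y d τ (fun x => τ ^ 2 * secondNeg ‖x‖ + energyRem ‖x‖ τ)
    (fun x x' => forceRem ‖x - x'‖ (dispB τ x + dispB τ x')) (fun x => farCol (dB x) + halfCol (dH x))
    hIa hd0 hdτ heR hfR (fun x x' => by rw [norm_sub_rev, add_comm (dispB τ x)]) hC
  beta_reduce at hcore
  -- the energy side: window = template sum, ball beyond the plane ≥ −halfEnergyCol, outside the ball ≥ −tailCol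
  have hint := integrable_lennardJones_of_isRootedHardCore h7 ⟨S, h0S, hS, rfl⟩
  have hwin : ∫ z in haloWindow n s Rc, lennardJones ‖z‖ ∂(Measure.count.restrict S : Measure E3) =
      ∑ x ∈ a.erase 0, phiT (‖x + d x‖ ^ 2) := by
    rw [setIntegral_eq_sum_atomOf_of_coherentOn hS hτ hW hcoh hballs ha (fun z => lennardJones ‖z‖)]
    beta_reduce
    rw [← Finset.sum_erase_add a _ h0a, atomOf_zero hS hτ h0S hτ0, norm_zero]
    have hV0 : lennardJones 0 = 0 := by unfold lennardJones; simp
    rw [hV0, add_zero]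
    exact Finset.sum_congr rfl fun x _ => by rw [lennardJones_eq_phiT, hq]
  have htail := (abs_le.mp (abs_setIntegral_compl_lennardJones_le hS hRc)).1
  have hhalf := setIntegral_ball_sdiff_lennardJones_ge (Rc := Rc) hn hs hS
  have hball : ∫ z in closedBall (0 : E3) Rc, lennardJones ‖z‖ ∂(Measure.count.restrict S : Measure E3) =
      (∫ z in haloWindow n s Rc, lennardJones ‖z‖ ∂(Measure.count.restrict S : Measure E3)) +
        ∫ z in closedBall (0 : E3) Rc \ {z : E3 | ⟪z, n⟫ ≤ s}, lennardJones ‖z‖ ∂(Measure.count.restrict S : Measure E3) := by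
    rw [haloWindow]
    exact (integral_inter_add_sdiff (measurableSet_halfSpace n s) hint.integrableOn).symm
  have hE : 2 * rootEnergy lennardJones (Measure.count.restrict S : Measure E3) =
      (∫ z in closedBall (0 : E3) Rc, lennardJones ‖z‖ ∂(Measure.count.restrict S : Measure E3)) +
        ∫ z in (closedBall (0 : E3) Rc)ᶜ, lennardJones ‖z‖ ∂(Measure.count.restrict S : Measure E3) := by
    rw [rootEnergy_def, integral_add_compl measurableSet_closedBall hint]
    ring
  rw [hE, hball, hwin]
  linarith

/-- ★★★ **T2-H with dialled clearances under the crux's own clauses** (Nash form). [folklore] -/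
theorem certFloorHalo_le_two_mul_rootEnergy_dial_of_nash {μ : Measure E3} {τ Rc s : ℝ} {a I : Finset E3} {n : E3} (y : E3 → E3)
    (dB dH : E3 → ℝ) (hn : ‖n‖ = 1) (hs : 1 ≤ s) (hμ : IsRootedHardCore (7 / 10) μ)
    (hNash : ∀ p : E3, μ {p} ≠ 0 → ∀ w : E3, (∀ q : E3, μ {q} ≠ 0 → q ≠ p → w ≠ q) →
      ∑' q : {q : E3 // μ {q} ≠ 0 ∧ q ≠ p}, lennardJones (dist p (q : E3)) ≤
        ∑' q : {q : E3 // μ {q} ≠ 0 ∧ q ≠ p}, lennardJones (dist w (q : E3)))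
    (hτ0 : 0 ≤ τ) (hτ : 2 * τ < 7 / 10) (hRc : 1 ≤ Rc) (hcoh : μ ∈ coherentOn a τ (haloWindow n s Rc))
    (h0a : (0 : E3) ∈ a) (hIa : I ⊆ a) (ha : ∀ x ∈ a, ∀ x' ∈ a, x ≠ x' → 2 * τ < dist x x')
    (hin : ∀ x ∈ a, ‖x‖ + τ ≤ Rc ∧ ⟪x, n⟫ + τ ≤ s) (hI : ∀ x ∈ I, (7 / 20 ≤ dB x ∧ dB x ≤ Rc - (‖x‖ + τ)) ∧ (7 / 20 ≤ dH x ∧ dH x ≤ s - (⟪x, n⟫ + τ))) :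
    ∑ x ∈ a.erase 0, (phiT (‖x‖ ^ 2) - (τ ^ 2 * secondNeg ‖x‖ + energyRem ‖x‖ τ))
        - τ * ∑ z ∈ a.erase 0, ‖psiT (‖z‖ ^ 2) • z - certCoeff a I y z‖
        - ∑ x ∈ I, ⟪y x, ∑ x' ∈ a.erase x, ljBondForce (x - x')⟫
        - ∑ x ∈ I, ‖y x‖ * (farCol (dB x) + halfCol (dH x))
        - 1 / 2 * ∑ x ∈ a, ∑ x' ∈ a.erase x, ‖mulExt I y x - mulExt I y x'‖ * forceRem ‖x - x'‖ (dispB τ x + dispB τ x')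
        - tailCol Rc - halfEnergyCol s
      ≤ 2 * rootEnergy lennardJones μ := by
  obtain ⟨S, h0S, hS, rfl⟩ := hμ
  have hW := measurableSet_haloWindow n s Rc
  have hne : ∀ z ∈ a, (closedBall z τ ∩ S).Nonempty := fun z hz => nonempty_of_mem_coherentOn hW hcoh hz
  refine certFloorHalo_le_two_mul_rootEnergy_dial y dB dH hn hs hS h0S hτ0 hτ hRc hcoh h0a hIa ha hin hI fun x hx => ?_
  have hp : (Measure.count.restrict S : Measure E3) {atomOf S τ x} ≠ 0 :=
    (count_restrict_singleton_ne_zero_iff S _).mpr (atomOf_mem (hne x (hIa hx))).2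
  exact hasSum_force_of_nash (by norm_num : (0 : ℝ) < 7 / 10) ⟨S, h0S, hS, rfl⟩ hp (hNash _ hp)


end Summit.AtomisticToContinuum.Crystallization.Theorems.FrustratedLawDichotomyCoherentFloorHaloDial

end
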